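import Mathlib
import Summits.Ventures.PercRepro2.HalfLA1BBlocks
import Summits.Ventures.PercRepro2.HalfLA2B

/-!
# HALF-L for `a₃ ~ {a₁, b}`, and (HCOV) for `a₃` adjacent exactly to a root and to `b`
(blind cell PercRepro2, night-1 g37)

`GammaLc_a1b`: for `CaseOne.IsTwoMarkAt ends a₁ b a₃ e₁ e₂`, `ΓLc = 2 · HalfLA1B.lhs (p e₁) (p e₂) (cellsA1B …)`;
**`HalfL_a1b`**: HALF-L on the class `a₃ ~ {a₁, b}`.  With `HalfLA2B.HalfL_a2b` and the root swap
`HalfH_iff` (HALF-H of an instance of one class is HALF-L of an instance of the other):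
**`HCov_a2b`**, **`HCov_a1b`** — (HCOV) whenever `a₃` is adjacent exactly to one root and to `b`, every
weight, every base graph.
-/

namespace Summit.Ventures.PercRepro2

namespace HalfLA1B

open CaseOne CovForm SharpHalves UnionCluster HalfLTwoMark HalfLA2B

section Main

variable {V : Type*} {E : Type*} [Fintype E] [DecidableEq E] [Fintype V] [DecidableEq V]
  {R : Type*} [Field R] [LinearOrder R] [IsStrictOrderedRing R]
variable {ends : E → Sym2 V} {o a₃ b : V} {e₁ e₂ : E}

omit [Fintype V] in
/-- **`ΓLc` for `a₃ ~ {a₁, b}`**: `ΓLc = 2 · lhs r₁ r₂ (cells)`. -/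
theorem GammaLc_a1b (p : E → R) {a₁ a₂ : V} (h : IsTwoMarkAt ends a₁ b a₃ e₁ e₂) (h2 : a₂ ≠ a₃)
    (ho3 : o ≠ a₃) :
    GammaLc p ends o a₁ a₂ a₃ b = 2 * lhs (p e₁) (p e₂) (cellsA1B p ends o a₁ a₂ b e₁ e₂) := by
  rw [HalfEndpoint.GammaLc_eq_endpoint p ends o a₁ a₂ a₃ b, HalfLTwoMark.Do_eq,
    HalfLTwoMark.avoidAll_eq_Q, HalfLTwoMark.TEvent_eq, HalfLTwoMark.Dtilde_eq]
  have ePD : PDEvent ends a₁ a₂ a₃ =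
      (connEvent ends a₁ a₂)ᶜ ∩ (connEvent ends a₃ a₁ ∪ connEvent ends a₃ a₂)ᶜ := rfl
  rw [ePD]
  have cT := prob_inter_add_prob_inter_compl p ((connEvent ends a₁ a₂)ᶜ ∩ connEvent ends a₂ a₃)
    (connEvent ends a₁ o ∪ connEvent ends a₂ o)
  have cTb := prob_inter_add_prob_inter_compl p
    ((connEvent ends a₁ a₂)ᶜ ∩ connEvent ends a₂ a₃ ∩ connEvent ends a₁ b)
    (connEvent ends a₁ o ∪ connEvent ends a₂ o)
  have eTb : (connEvent ends a₁ a₂)ᶜ ∩ connEvent ends a₂ a₃ ∩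
      (connEvent ends a₁ b ∩ (connEvent ends a₁ o ∪ connEvent ends a₂ o)ᶜ) =
      (connEvent ends a₁ a₂)ᶜ ∩ connEvent ends a₂ a₃ ∩ connEvent ends a₁ b ∩
        (connEvent ends a₁ o ∪ connEvent ends a₂ o)ᶜ := (Set.inter_assoc _ _ _).symm
  have ebLoH : (connEvent ends a₁ a₂)ᶜ ∩ (connEvent ends a₂ o ∩ connEvent ends a₁ b) =
      (connEvent ends a₁ a₂)ᶜ ∩ connEvent ends a₂ o ∩ connEvent ends a₁ b := (Set.inter_assoc _ _ _).symm
  rw [eTb, ebLoH]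
  rw [mass_Q (o := o) p h h2, mass_bL (o := o) p h h2, mass_T (o := o) p h h2, mass_TbL (o := o) p h h2,
    mass_TbLoU p h h2, mass_oH p h h2 ho3, mass_bLoH p h h2 ho3, mass_ToU p h h2 ho3,
    mass_PD (o := o) p h h2, mass_PDoU p h h2 ho3] at *
  unfold lhs
  linear_combination (2 * mPD (p e₁) (p e₂) (cellsA1B p ends o a₁ a₂ b e₁ e₂) *
      mbL (p e₁) (p e₂) (cellsA1B p ends o a₁ a₂ b e₁ e₂)) * cT -
    (2 * mPD (p e₁) (p e₂) (cellsA1B p ends o a₁ a₂ b e₁ e₂) *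
      mQ (p e₁) (p e₂) (cellsA1B p ends o a₁ a₂ b e₁ e₂)) * cTb

/-- **HALF-L on the class `a₃ ~ {a₁, b}`**, every weight. -/
theorem HalfL_a1b (p : E → R) (hp : IsProbVec p) {a₁ a₂ : V} (h : IsTwoMarkAt ends a₁ b a₃ e₁ e₂)
    (h2 : a₂ ≠ a₃) (ho3 : o ≠ a₃) : HalfL p ends o a₁ a₂ a₃ b := by
  unfold HalfL
  rw [GammaLc_a1b p h h2 ho3]
  have := lhs_nonneg (p e₁) (p e₂) (cellsA1B p ends o a₁ a₂ b e₁ e₂)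
    (cellsNonneg p hp ends o a₁ a₂ b e₁ e₂) (blocksNonneg p hp ends o a₁ a₂ b e₁ e₂)
    (hp.nonneg e₁) (hp.le_one e₁) (hp.nonneg e₂) (hp.le_one e₂)
  linarith

/-- **(HCOV) for `a₃ ~ {a₂, b}`**: HALF-L by `HalfL_a2b`, HALF-H = HALF-L of the root-swapped instance
(class `a₃ ~ {first root, b}`) by `HalfL_a1b`. -/
theorem HCov_a2b (p : E → R) (hp : IsProbVec p) {a₁ a₂ : V} (h : IsTwoMarkAt ends a₂ b a₃ e₁ e₂)
    (h1 : a₁ ≠ a₃) (ho3 : o ≠ a₃) : HCov p ends o a₁ a₂ a₃ b :=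
  HCov_of_HalfL_HalfH p ends o a₁ a₂ a₃ b (HalfL_a2b p hp h h1 ho3)
    ((HalfH_iff p ends o a₁ a₂ a₃ b).2 (HalfL_a1b p hp h h1 ho3))

/-- **(HCOV) for `a₃ ~ {a₁, b}`**: HALF-L by `HalfL_a1b`, HALF-H by `HalfL_a2b` on the root-swapped instance. -/
theorem HCov_a1b (p : E → R) (hp : IsProbVec p) {a₁ a₂ : V} (h : IsTwoMarkAt ends a₁ b a₃ e₁ e₂)
    (h2 : a₂ ≠ a₃) (ho3 : o ≠ a₃) : HCov p ends o a₁ a₂ a₃ b :=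
  HCov_of_HalfL_HalfH p ends o a₁ a₂ a₃ b (HalfL_a1b p hp h h2 ho3)
    ((HalfH_iff p ends o a₁ a₂ a₃ b).2 (HalfL_a2b p hp h h2 ho3))

end Main

end HalfLA1B

end Summit.Ventures.PercRepro2
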